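import Literature.Geometry.Lorentzian.CylinderUnitNormal
import Literature.Geometry.Lorentzian.ChartSecondFundamentalForm
import Literature.Geometry.Lorentzian.ChartConnection
import HarnessLib

/-!
# The data induced on the Schwarzschild cylinder by an arbitrary metric, as jet substitutions

Support file (all results proved; definitions with bodies, theorems; no named facts) for the
transport of J. Li, H. Mei, *A construction of collapsing spacetimes in vacuum*, Comm. Math. Phys.
378 (2020) = arXiv:2005.01249, §2.2, p. 8 — "We denote this hypersurface … by `H` and the initial
data induced on it by `g` by `(ḡ, k̄)` … The closeness to Schwarzschild metric implies that
`‖ḡ − ḡ_{m₀}‖_{C^k(ḡ_{m₀})} + ‖k̄ − k̄_{m₀}‖_{C^k(ḡ_{m₀})} ≤ C δ^{1/2}`" — to the tree's vocabulary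
(`LiMei.NearSchwarzschildCylinder`, `InteriorKerrGluing.lean`). The mechanism behind "implies" is
that BOTH fundamental forms of the FIXED cylinder map `ψ = schwCylMap r₀ 0` with respect to a metric
of coefficients `G` are obtained by substituting the `1`-jet `(G(ψ y), DG(ψ y))` into FIXED smooth
functions:

* `hSubst r₀ ((y, v, w), (β, β')) = β(dψ_y v, dψ_y w)` — the induced metric;
* `kSubst r₀ ((y, v, w), (β, β')) = β(N' v, dψ_y w) + ½ (β'(dψ_y v)(N)(dψ_y w) + β'(N)(dψ_y w)(dψ_y v)
  − β'(dψ_y w)(dψ_y v)(N))` with `N = unitNormalOf (y, β)` (`CylinderUnitNormal.lean`) and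
  `N' v = D(unitNormalOf)(y, β)(v, β'(dψ_y v))` — the second fundamental form in the chart formula
  `K(v, w) = g(DN v + Γ(N)(dψ v), dψ w)`, `g(Γ(N)Ṽ, W̃) = ½ Kos_G(N, Ṽ, W̃)`
  (`OpensChart.secondFundamentalForm_eq_of_repr`, `OpensChart.val_christoffel_const`; O'Neill 1983,
  Ch. 4, Lemma 4.1 / 4.4, Ch. 3, Prop. 3.13);

both smooth on explicit open sets (`contDiffOn_hSubst`, `contDiffOn_kSubst`). The identification
theorems `inducedBilin_eq_hSubst`, `secondFundamentalForm_eq_kSubst` hold along ANY smooth map `f`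
from a chart domain of `E3` into a chart domain of `E4` with Lorentzian metric of coefficients `G`,
at the points of an open set on which `f` agrees with `ψ` and its unit normal points to decreasing
area radius; `gbarRep_eq_hSubst`, `kbarRep_eq_kSubst` are the model case `G = g_M` (Li–Mei (4.1)).
The `C^k` estimate itself (`Literature.Analysis.Calculus.exists_norm_iteratedFDeriv_substitution_sub_le`)
is applied in `ShortPulseTransport.lean`.

## References

* J. Li, H. Mei, arXiv:2005.01249, §2.2 and (4.1) (key `LiMei2020`).
* B. O'Neill, *Semi-Riemannian geometry* (1983), Ch. 3, Prop. 3.13; Ch. 4, Lemma 4.1, 4.4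
  (key `ONeill1983`).
-/

noncomputable section

set_option synthInstance.maxHeartbeats 200000

open Bundle Set Function Filter Manifold TopologicalSpace Module
open scoped Manifold ContDiff Topology RealInnerProductSpace

namespace Literature.Geometry.Lorentzian

namespace LiMei

/-- The space of bilinear forms on `E4` (metric coefficients). -/
local notation "Bil" => E4 →L[ℝ] E4 →L[ℝ] ℝ

/-- The `1`-jets of metric coefficients: a value and a derivative. -/
local notation "Jet" => (E4 →L[ℝ] E4 →L[ℝ] ℝ) × (E4 →L[ℝ] E4 →L[ℝ] E4 →L[ℝ] ℝ)

/-- The substitution variable `(y, v, w)`: a point of the annulus and two test vectors. -/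
local notation "Var" => E3 × (E3 × E3)

/-! ### Shortcut instances

The normed-space structures on the jet spaces are the canonical ones; registering them as local
instances keeps typeclass synthesis on the nested products/hom-spaces within budget. -/

/-- Shortcut (canonical instance). -/
local instance instNormedAddCommGroupBil : NormedAddCommGroup Bil :=
  ContinuousLinearMap.toNormedAddCommGroup

/-- Shortcut (canonical instance). -/
local instance instNormedSpaceBil : NormedSpace ℝ Bil := ContinuousLinearMap.toNormedSpace

/-- Shortcut (canonical instance). -/
local instance instNormedAddCommGroupDBil : NormedAddCommGroup (E4 →L[ℝ] Bil) :=
  ContinuousLinearMap.toNormedAddCommGroup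

/-- Shortcut (canonical instance). -/
local instance instNormedSpaceDBil : NormedSpace ℝ (E4 →L[ℝ] Bil) :=
  ContinuousLinearMap.toNormedSpace

/-- Shortcut (canonical instance). -/
local instance instNormedAddCommGroupJet : NormedAddCommGroup Jet := Prod.normedAddCommGroup

/-- Shortcut (canonical instance). -/
local instance instNormedSpaceJet : NormedSpace ℝ Jet := Prod.normedSpace

/-- Shortcut (canonical instance). -/
local instance instNormedAddCommGroupVar : NormedAddCommGroup Var := Prod.normedAddCommGroup

/-- Shortcut (canonical instance). -/
local instance instNormedSpaceVar : NormedSpace ℝ Var := Prod.normedSpace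

/-- Shortcut (canonical instance). -/
local instance instNormedAddCommGroupVarJet : NormedAddCommGroup (Var × Jet) :=
  Prod.normedAddCommGroup

/-- Shortcut (canonical instance). -/
local instance instNormedSpaceVarJet : NormedSpace ℝ (Var × Jet) := Prod.normedSpace

/-- Shortcut (canonical instance). -/
local instance instNormedAddCommGroupE3Bil : NormedAddCommGroup (E3 × Bil) :=
  Prod.normedAddCommGroup

/-- Shortcut (canonical instance). -/
local instance instNormedSpaceE3Bil : NormedSpace ℝ (E3 × Bil) := Prod.normedSpace

/-- Shortcut (canonical instance). -/
local instance instNormedAddCommGroupE3BilProd : NormedAddCommGroup (E3 × Bil →L[ℝ] E4) :=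
  ContinuousLinearMap.toNormedAddCommGroup

/-- Shortcut (canonical instance). -/
local instance instNormedSpaceE3BilProd : NormedSpace ℝ (E3 × Bil →L[ℝ] E4) :=
  ContinuousLinearMap.toNormedSpace

/-! ### The model differential as a smooth function -/

/-- `y ↦ dψ_y = schwCylDeriv r₀ y` is `C^n` off the origin (it is the derivative of the smooth
cylinder map there). [folklore] -/
theorem contDiffAt_schwCylDeriv (r₀ : ℝ) {y : E3} (hy : y ≠ 0) {n : ℕ∞ω} :
    ContDiffAt ℝ n (schwCylDeriv r₀) y := by
  have h : ContDiffAt ℝ n (fderiv ℝ (schwCylMap r₀ 0)) y :=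
    (contDiffAt_schwCylMap r₀ 0 hy (n := n + 1)).fderiv_right le_rfl
  refine h.congr_of_eventuallyEq ?_
  filter_upwards [isOpen_ne.mem_nhds hy] with z hz
  exact (fderiv_schwCylMap r₀ 0 hz).symm

/-! ### Jets and the two substitution maps -/

/-- The `1`-JET of the coefficient field `G` at the cylinder point `ψ y`: `(G(ψ y), DG(ψ y))`.
[folklore] -/
def jetOf (G : E4 → Bil) (r₀ : ℝ) (y : E3) : Jet :=
  (G (schwCylMap r₀ 0 y), fderiv ℝ G (schwCylMap r₀ 0 y))

/-- The METRIC SUBSTITUTION `β(dψ_y v, dψ_y w)`. [cite: LiMei2020, (4.1)] -/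
def hSubst (r₀ : ℝ) (q : Var × Jet) : ℝ :=
  q.2.1 (schwCylDeriv r₀ q.1.1 q.1.2.1) (schwCylDeriv r₀ q.1.1 q.1.2.2)

/-- The derivative of the unit normal along the cylinder in the direction `v`, as a function of the
jet: `D(unitNormalOf)(y, β)(v, β'(dψ_y v))` (the chain rule for `y ↦ unitNormalOf (y, G(ψ y))`).
[folklore] -/
def normalDeriv (r₀ : ℝ) (y : E3) (J : Jet) (v : E3) : E4 :=
  fderiv ℝ unitNormalOf (y, J.1) (v, J.2 (schwCylDeriv r₀ y v))

/-- The SECOND-FUNDAMENTAL-FORM SUBSTITUTION: the chart formula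
`K(v, w) = β(N' v, dψ_y w) + ½ (β'(dψ_y v)(N)(dψ_y w) + β'(N)(dψ_y w)(dψ_y v) − β'(dψ_y w)(dψ_y v)(N))`
with `N = unitNormalOf (y, β)`, `N' = normalDeriv`. O'Neill 1983, Ch. 4, Lemma 4.1 / 4.4 and Ch. 3,
Prop. 3.13 (Koszul formula in coordinates). [cite: ONeill1983, Ch. 4, Lemma 4.4] -/
def kSubst (r₀ : ℝ) (q : Var × Jet) : ℝ :=
  q.2.1 (normalDeriv r₀ q.1.1 q.2 q.1.2.1) (schwCylDeriv r₀ q.1.1 q.1.2.2) +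
    2⁻¹ * (q.2.2 (schwCylDeriv r₀ q.1.1 q.1.2.1) (unitNormalOf (q.1.1, q.2.1))
        (schwCylDeriv r₀ q.1.1 q.1.2.2) +
      q.2.2 (unitNormalOf (q.1.1, q.2.1)) (schwCylDeriv r₀ q.1.1 q.1.2.2)
        (schwCylDeriv r₀ q.1.1 q.1.2.1) -
      q.2.2 (schwCylDeriv r₀ q.1.1 q.1.2.2) (schwCylDeriv r₀ q.1.1 q.1.2.1)
        (unitNormalOf (q.1.1, q.2.1)))

/-- The domain of smoothness of `hSubst`: `{y ≠ 0}`. [folklore] -/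
def hDomain : Set (Var × Jet) := {q | q.1.1 ≠ 0}

/-- The domain of smoothness of `kSubst`: `{y ≠ 0, (y, β) ∈ normalDomain}`. [folklore] -/
def kDomain : Set (Var × Jet) := {q | q.1.1 ≠ 0 ∧ (q.1.1, q.2.1) ∈ normalDomain}

/-- Membership in `hDomain`. [folklore] -/
@[simp] theorem mem_hDomain {q : Var × Jet} : q ∈ hDomain ↔ q.1.1 ≠ 0 := Iff.rfl

/-- Membership in `kDomain`. [folklore] -/
@[simp] theorem mem_kDomain {q : Var × Jet} :
    q ∈ kDomain ↔ q.1.1 ≠ 0 ∧ (q.1.1, q.2.1) ∈ normalDomain := Iff.rfl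

/-- `hDomain` is open. [folklore] -/
theorem isOpen_hDomain : IsOpen hDomain :=
  isOpen_ne.preimage (continuous_fst.comp continuous_fst)

/-- `kDomain` is open. [folklore] -/
theorem isOpen_kDomain : IsOpen kDomain :=
  (isOpen_ne.preimage (continuous_fst.comp continuous_fst)).inter
    (isOpen_normalDomain.preimage
      ((continuous_fst.comp continuous_fst).prodMk (continuous_fst.comp continuous_snd)))

/-! ### Smoothness of the substitution maps -/

/-- `q ↦ dψ_{y}` is smooth on `{y ≠ 0}`. [folklore] -/
theorem contDiffAt_schwCylDeriv_var (r₀ : ℝ) {q : Var × Jet} (hq : q.1.1 ≠ 0) {n : ℕ∞ω} :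
    ContDiffAt ℝ n (fun q : Var × Jet ↦ schwCylDeriv r₀ q.1.1) q :=
  (contDiffAt_schwCylDeriv r₀ hq).comp q contDiffAt_fst.fst

/-- **`hSubst` is smooth on `hDomain`.** [folklore] -/
theorem contDiffOn_hSubst (r₀ : ℝ) {n : ℕ∞ω} : ContDiffOn ℝ n (hSubst r₀) hDomain := by
  intro q hq
  have hD := contDiffAt_schwCylDeriv_var r₀ (n := n) hq
  have hA : ContDiffAt ℝ n (fun q : Var × Jet ↦ schwCylDeriv r₀ q.1.1 q.1.2.1) q :=
    hD.clm_apply contDiffAt_fst.snd.fst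
  have hB : ContDiffAt ℝ n (fun q : Var × Jet ↦ schwCylDeriv r₀ q.1.1 q.1.2.2) q :=
    hD.clm_apply contDiffAt_fst.snd.snd
  exact ((contDiffAt_snd.fst.clm_apply hA).clm_apply hB).contDiffWithinAt

/-- **`kSubst` is smooth on `kDomain`** (`unitNormalOf` and its derivative are smooth on the open
`normalDomain`, `contDiffOn_unitNormalOf`). [folklore] -/
theorem contDiffOn_kSubst (r₀ : ℝ) : ContDiffOn ℝ ∞ (kSubst r₀) kDomain := by
  intro q hq
  obtain ⟨hy, hmem⟩ := hq
  have hπ : ContDiffAt ℝ ∞ (fun q : Var × Jet ↦ ((q.1.1, q.2.1) : E3 × Bil)) q :=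
    contDiffAt_fst.fst.prodMk contDiffAt_snd.fst
  have hN : ContDiffAt ℝ ∞ (fun q : Var × Jet ↦ unitNormalOf (q.1.1, q.2.1)) q :=
    ContDiffAt.comp (g := unitNormalOf) (f := fun q : Var × Jet ↦ ((q.1.1, q.2.1) : E3 × Bil)) q
      ((contDiffOn_unitNormalOf _ hmem).contDiffAt (isOpen_normalDomain.mem_nhds hmem)) hπ
  have hDN : ContDiffAt ℝ ∞ (fun q : Var × Jet ↦ fderiv ℝ unitNormalOf (q.1.1, q.2.1)) q :=
    ContDiffAt.comp (g := fderiv ℝ unitNormalOf)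
      (f := fun q : Var × Jet ↦ ((q.1.1, q.2.1) : E3 × Bil)) q
      ((((contDiffOn_unitNormalOf (n := ∞)).fderiv_of_isOpen isOpen_normalDomain (by simp)) _
        hmem).contDiffAt (isOpen_normalDomain.mem_nhds hmem)) hπ
  have hD := contDiffAt_schwCylDeriv_var r₀ (n := ∞) hy
  have hA : ContDiffAt ℝ ∞ (fun q : Var × Jet ↦ schwCylDeriv r₀ q.1.1 q.1.2.1) q :=
    hD.clm_apply contDiffAt_fst.snd.fst
  have hB : ContDiffAt ℝ ∞ (fun q : Var × Jet ↦ schwCylDeriv r₀ q.1.1 q.1.2.2) q :=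
    hD.clm_apply contDiffAt_fst.snd.snd
  have hvec : ContDiffAt ℝ ∞
      (fun q : Var × Jet ↦ ((q.1.2.1, q.2.2 (schwCylDeriv r₀ q.1.1 q.1.2.1)) : E3 × Bil)) q :=
    contDiffAt_fst.snd.fst.prodMk (contDiffAt_snd.snd.clm_apply hA)
  have hND : ContDiffAt ℝ ∞ (fun q : Var × Jet ↦ normalDeriv r₀ q.1.1 q.2 q.1.2.1) q :=
    hDN.clm_apply hvec
  have h₁ : ContDiffAt ℝ ∞ (fun q : Var × Jet ↦
      q.2.1 (normalDeriv r₀ q.1.1 q.2 q.1.2.1) (schwCylDeriv r₀ q.1.1 q.1.2.2)) q :=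
    (contDiffAt_snd.fst.clm_apply hND).clm_apply hB
  have hβ' : ContDiffAt ℝ ∞ (fun q : Var × Jet ↦ q.2.2) q := contDiffAt_snd.snd
  have h₂ : ContDiffAt ℝ ∞ (fun q : Var × Jet ↦ q.2.2 (schwCylDeriv r₀ q.1.1 q.1.2.1)
      (unitNormalOf (q.1.1, q.2.1)) (schwCylDeriv r₀ q.1.1 q.1.2.2)) q :=
    ((hβ'.clm_apply hA).clm_apply hN).clm_apply hB
  have h₃ : ContDiffAt ℝ ∞ (fun q : Var × Jet ↦ q.2.2 (unitNormalOf (q.1.1, q.2.1))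
      (schwCylDeriv r₀ q.1.1 q.1.2.2) (schwCylDeriv r₀ q.1.1 q.1.2.1)) q :=
    ((hβ'.clm_apply hN).clm_apply hB).clm_apply hA
  have h₄ : ContDiffAt ℝ ∞ (fun q : Var × Jet ↦ q.2.2 (schwCylDeriv r₀ q.1.1 q.1.2.2)
      (schwCylDeriv r₀ q.1.1 q.1.2.1) (unitNormalOf (q.1.1, q.2.1))) q :=
    ((hβ'.clm_apply hB).clm_apply hA).clm_apply hN
  exact (h₁.add (contDiffAt_const.mul ((h₂.add h₃).sub h₄))).contDiffWithinAt

/-! ### Identification along a frame that agrees with the cylinder on an open set -/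

section Frame

variable {V : Opens E4} {Uo : Opens E3} (g : LorentzianMetric 𝓘(ℝ, E4) ∞ V)
  (G : E4 → Bil) (hG : ∀ x : V, g.val x = G x) {r₀ : ℝ} {f : Uo → V}
  {ν : NormalField 𝓘(ℝ, E4) f} {Φ N : E3 → E4} (hΦ : ∀ y : Uo, (f y : E4) = Φ y)
  (hN : ∀ y : Uo, ν y = N y) (hfi : g.IsSpacelikeImmersion 𝓘(ℝ, E3) f)
  (hν : g.IsUnitNormal 𝓘(ℝ, E3) f ν (-1)) {S : Set E3} (hS : IsOpen S) (hS0 : ∀ y ∈ S, y ≠ 0)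
  (hΦS : ∀ y ∈ S, Φ y = schwCylMap r₀ 0 y)
  (hor : ∀ y : Uo, (y : E3) ∈ S → ⟪(y : E3), E4.spatial (ν y)⟫ < 0)
  (hGd : ∀ y : Uo, (y : E3) ∈ S → DifferentiableAt ℝ G (schwCylMap r₀ 0 y))

include hS hΦS in
/-- On `S` the representative `Φ` is differentiable with differential `dψ`. [folklore] -/
theorem differentiableAt_and_fderiv_eq_of_agree {y : E3} (hy : y ∈ S) (hy0 : y ≠ 0) :
    DifferentiableAt ℝ Φ y ∧ fderiv ℝ Φ y = schwCylDeriv r₀ y := by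
  have hev : Φ =ᶠ[𝓝 y] schwCylMap r₀ 0 := by
    filter_upwards [hS.mem_nhds hy] with z hz
    exact hΦS z hz
  exact ⟨(differentiableAt_schwCylMap r₀ 0 hy0).congr_of_eventuallyEq hev,
    by rw [hev.fderiv_eq, fderiv_schwCylMap r₀ 0 hy0]⟩

include hΦ hS hS0 hΦS in
/-- On `S` the differential of `f` is `dψ`. [folklore] -/
theorem mfderiv_apply_eq_schwCylDeriv (y : Uo) (hy : (y : E3) ∈ S) (v : E3) :
    mfderiv 𝓘(ℝ, E3) 𝓘(ℝ, E4) f y v = schwCylDeriv r₀ (y : E3) v := by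
  obtain ⟨hd, he⟩ := differentiableAt_and_fderiv_eq_of_agree (r₀ := r₀) hS hΦS hy (hS0 _ hy)
  rw [OpensChart.mfderiv_apply_of_repr hΦ hd, he]

include hG hΦ hN hfi hν hS hS0 hΦS hor in
/-- **On `S` the unit normal is `unitNormalOf` of the jet** (`CylinderUnitNormal.eq_unitNormalOf`).
[cite: ONeill1983, Ch. 5, Lemma 5.26] -/
theorem mem_normalDomain_and_eq_unitNormalOf (y : Uo) (hy : (y : E3) ∈ S) :
    ((y : E3), G (schwCylMap r₀ 0 y)) ∈ normalDomain ∧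
      N y = unitNormalOf ((y : E3), G (schwCylMap r₀ 0 y)) := by
  have hy0 : (y : E3) ≠ 0 := hS0 _ hy
  have hmf := mfderiv_apply_eq_schwCylDeriv (r₀ := r₀) hΦ hS hS0 hΦS y hy
  have hval : g.val (f y) = G (schwCylMap r₀ 0 y) := by rw [hG, hΦ, hΦS _ hy]
  have hpos : ∀ v : E3, v ≠ 0 → 0 < g.val (f y) (schwCylDeriv r₀ (y : E3) v)
      (schwCylDeriv r₀ (y : E3) v) := fun v hv ↦ by
    have h := hfi.inducedBilin_pos y hv
    rwa [PseudoRiemannianMetric.inducedBilin_apply, hmf] at h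
  have hn : ∀ v : E3, g.val (f y) (N y) (schwCylDeriv r₀ (y : E3) v) = 0 := fun v ↦ by
    have h := hν.1 y v
    rwa [hmf, hN] at h
  have hu : g.val (f y) (N y) (N y) = -1 := by
    have h := hν.2 y
    rwa [hN] at h
  have hor' : ⟪(y : E3), E4.spatial (N y)⟫ < 0 := by
    have h := hor y hy
    rwa [hN] at h
  have h := eq_unitNormalOf g (f y) (r₀ := r₀) hy0 hpos hn hu hor'
  rw [hval] at h
  exact h

include hG hΦ hN hfi hν hS hS0 hΦS hor hGd in
/-- **On `S` the normal representative is differentiable with differential `normalDeriv` of the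
jet** (chain rule for `y ↦ unitNormalOf (y, G(ψ y))`). [folklore] -/
theorem differentiableAt_and_fderiv_normal (y : Uo) (hy : (y : E3) ∈ S) :
    DifferentiableAt ℝ N y ∧
      ∀ v : E3, fderiv ℝ N y v = normalDeriv r₀ (y : E3) (jetOf G r₀ y) v := by
  have hy0 : (y : E3) ≠ 0 := hS0 _ hy
  -- `N = unitNormalOf ∘ (id, G ∘ ψ)` near `y`
  have hev : N =ᶠ[𝓝 (y : E3)] fun z ↦ unitNormalOf (z, G (schwCylMap r₀ 0 z)) := by
    filter_upwards [hS.mem_nhds hy, Uo.isOpen.mem_nhds y.2] with z hzS hzU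
    exact (mem_normalDomain_and_eq_unitNormalOf g G hG hΦ hN hfi hν hS hS0 hΦS hor ⟨z, hzU⟩ hzS).2
  have hmem := (mem_normalDomain_and_eq_unitNormalOf g G hG hΦ hN hfi hν hS hS0 hΦS hor y hy).1
  -- the chain rule
  have hφ : HasFDerivAt (fun z : E3 ↦ ((z, G (schwCylMap r₀ 0 z)) : E3 × Bil))
      ((ContinuousLinearMap.id ℝ E3).prod
        ((fderiv ℝ G (schwCylMap r₀ 0 y)).comp (schwCylDeriv r₀ (y : E3)))) y :=
    (hasFDerivAt_id (y : E3)).prodMk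
      ((hGd y hy).hasFDerivAt.comp (y : E3) (hasFDerivAt_schwCylMap r₀ 0 hy0))
  have hU : HasFDerivAt unitNormalOf (fderiv ℝ unitNormalOf ((y : E3), G (schwCylMap r₀ 0 y)))
      ((y : E3), G (schwCylMap r₀ 0 y)) :=
    (((contDiffOn_unitNormalOf (n := 1)).differentiableOn one_ne_zero).differentiableAt
      (isOpen_normalDomain.mem_nhds hmem)).hasFDerivAt
  have hcomp : HasFDerivAt (fun z : E3 ↦ unitNormalOf (z, G (schwCylMap r₀ 0 z)))
      ((fderiv ℝ unitNormalOf ((y : E3), G (schwCylMap r₀ 0 y))).comp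
        ((ContinuousLinearMap.id ℝ E3).prod
          ((fderiv ℝ G (schwCylMap r₀ 0 y)).comp (schwCylDeriv r₀ (y : E3))))) y := by
    have h := hU.comp (y : E3) hφ
    exact h
  refine ⟨hcomp.differentiableAt.congr_of_eventuallyEq hev, fun v ↦ ?_⟩
  rw [hev.fderiv_eq, hcomp.fderiv]
  rfl

variable [g.HasLeviCivita]

include hG hΦ hN hfi hν hS hS0 hΦS hor hGd in
/-- **The second fundamental form along the cylinder is the substitution of the jet into
`kSubst`.** For `f : Uo → V` with representatives `Φ`, `N` of `f`, `ν` (a spacelike immersion with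
unit normal of sign `−1` for the Lorentzian metric `g` of coefficients `G`), agreeing with
`ψ = schwCylMap r₀ 0` on the open set `S ∌ 0` where `ν` points to decreasing area radius:
`K_ν(f)(y)(v, w) = kSubst r₀ ((y, v, w), (G(ψ y), DG(ψ y)))` at every `y ∈ S`. The chart formula
`OpensChart.secondFundamentalForm_eq_of_repr`, the first-kind Christoffel symbols
`OpensChart.val_christoffel_const`, `dΦ = dψ`, `N = unitNormalOf (·, G(ψ ·))` and the chain rule.
O'Neill 1983, Ch. 4, Lemma 4.1 / 4.4; Li–Mei arXiv:2005.01249, §2.2. [cite: ONeill1983, Ch. 4, Lemma 4.4] -/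
theorem secondFundamentalForm_eq_kSubst (y : Uo) (hy : (y : E3) ∈ S) (v w : E3) :
    g.secondFundamentalForm 𝓘(ℝ, E3) f ν y v w =
      kSubst r₀ (((y : E3), (v, w)), jetOf G r₀ y) := by
  have hy0 : (y : E3) ≠ 0 := hS0 _ hy
  obtain ⟨hΦd, hΦe⟩ := differentiableAt_and_fderiv_eq_of_agree (r₀ := r₀) hS hΦS hy hy0
  obtain ⟨hNd, hNe⟩ := differentiableAt_and_fderiv_normal g G hG hΦ hN hfi hν hS hS0 hΦS hor hGd y hy
  obtain ⟨-, hNu⟩ := mem_normalDomain_and_eq_unitNormalOf g G hG hΦ hN hfi hν hS hS0 hΦS hor y hy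
  have hfy : (f y : E4) = schwCylMap r₀ 0 y := by rw [hΦ, hΦS _ hy]
  have hGd' : DifferentiableAt ℝ G (f y) := by rw [hfy]; exact hGd y hy
  rw [OpensChart.secondFundamentalForm_eq_of_repr (g := g.toPseudoRiemannianMetric) (G := G) hG hΦ hN
    hΦd hNd hGd' v w, hΦe, hNe v]
  -- the Christoffel symbols of the first kind: `g(Γ(N)(Ṽ), W̃) = ½ Kos(N, Ṽ, W̃)`
  have hΓ := OpensChart.val_christoffel_const (g := g.toPseudoRiemannianMetric) (G := G) (f y) (N y)
    (schwCylDeriv r₀ (y : E3) v) (schwCylDeriv r₀ (y : E3) w)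
  -- read the pairing `g_{f y}` as the bilinear form `G (ψ y)` on `E4`
  have hval₂ : ∀ a b : E4, g.val (f y) a b = G (schwCylMap r₀ 0 y) a b := fun a b ↦ by
    rw [hG, hfy]
    rfl
  rw [hval₂] at hΓ ⊢
  rw [map_add, add_apply, hΓ, OpensChart.koszulForm_apply, hNu, hfy]
  rfl

omit [g.HasLeviCivita] in
include hG hΦ hS hS0 hΦS in
/-- **The induced metric along the cylinder is the substitution of the jet into `hSubst`.**
[cite: LiMei2020, (4.1)] -/
theorem inducedBilin_eq_hSubst (y : Uo) (hy : (y : E3) ∈ S) (v w : E3) :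
    g.val (f y) (mfderiv 𝓘(ℝ, E3) 𝓘(ℝ, E4) f y v) (mfderiv 𝓘(ℝ, E3) 𝓘(ℝ, E4) f y w) =
      hSubst r₀ (((y : E3), (v, w)), jetOf G r₀ y) := by
  rw [mfderiv_apply_eq_schwCylDeriv (r₀ := r₀) hΦ hS hS0 hΦS y hy,
    mfderiv_apply_eq_schwCylDeriv (r₀ := r₀) hΦ hS hS0 hΦS y hy, hG, hΦ, hΦS _ hy]
  rfl

end Frame

/-! ### The model jets: Li–Mei (4.1) as substitutions -/

/-- **(4.1a) as a substitution**: `ḡ_M(y)(v, w) = hSubst r₀ ((y, v, w), jet of g_M)` for `y ≠ 0`.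
[cite: LiMei2020, (4.1)] -/
theorem gbarRep_eq_hSubst (M : ℝ) {r₀ : ℝ} (hr₀ : 0 < r₀) {y : E3} (hy : y ≠ 0) (v w : E3) :
    gbarRep M r₀ y v w = hSubst r₀ ((y, (v, w)), jetOf (Kerr.bilin M 0) r₀ y) := by
  rw [← bilin_schwCylDeriv M hr₀ 0 hy v w]
  rfl

/-- **(4.1b) as a substitution**: `k̄_M(y)(v, w) = kSubst r₀ ((y, v, w), jet of g_M)` on
`{1 < ‖y‖}` (through the tree's pinned frame `ψ : Kerr.slice 0 1 → Kerr.region 0 (r₀/2)` and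
`secondFundamentalForm_schwCyl`). [cite: LiMei2020, (4.1)] -/
theorem kbarRep_eq_kSubst [Kerr.Facts] {M r₀ : ℝ} (hr₀ : 0 < r₀) (h2M : r₀ < 2 * M)
    (y : Kerr.slice 0 1) (v w : E3) :
    kbarRep M r₀ y v w = kSubst r₀ (((y : E3), (v, w)), jetOf (Kerr.bilin M 0) r₀ y) := by
  have hM : 0 ≤ M := by linarith
  have hr₁ : r₀ / 2 < r₀ := by linarith
  obtain ⟨ψ, hψ⟩ := exists_schwCylFrame (r₁ := r₀ / 2) hr₀ hr₁ 0
  haveI hLC : (Kerr.smoothMetric M 0 (r₀ / 2)).HasLeviCivita := PseudoRiemannianMetric.hasLeviCivita _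
  have hνF := isFutureUnitNormal_schwCylNormal (r₁ := r₀ / 2) hM hr₀ h2M 0 hψ
  rw [← secondFundamentalForm_schwCyl hM hr₀ h2M 0 hψ hνF y v w]
  refine secondFundamentalForm_eq_kSubst (Kerr.smoothMetric M 0 (r₀ / 2)) (Kerr.bilin M 0)
    (Kerr.smoothMetric_val M 0 (r₀ / 2)) (f := ψ) (Φ := schwCylMap r₀ 0)
    (N := schwCylNormalRep M r₀) hψ (fun _ ↦ rfl) (isSpacelikeImmersion_schwCyl hr₀ h2M 0 hψ) hνF.1
    (S := {z : E3 | z ≠ 0}) isOpen_ne (fun _ hz ↦ hz) (fun _ _ ↦ rfl)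
    (fun z _ ↦ inner_spatial_schwCylNormalRep_neg hr₀ h2M (ne_zero_of_mem_slice z))
    (fun z _ ↦ ?_) y (ne_zero_of_mem_slice y) v w
  exact (Kerr.contDiffAt_bilin M 0 (n := 1) (by
    rw [radius_schwCylMap hr₀ 0 (ne_zero_of_mem_slice z)]; exact hr₀)).differentiableAt one_ne_zero

end LiMei

end Literature.Geometry.Lorentzian

end
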